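import Summits.QuantumFields.BalabanUV.T4Continuum.Spine.NE3.LandauProjectionCurvedCore
import Summits.QuantumFields.BalabanUV.T4Continuum.Spine.NE3.CovariantMeanValue
import Summits.QuantumFields.BalabanUV.T4Continuum.Spine.NE3.AxialGaugeDivergence
import Mathlib.Algebra.Order.Chebyshev
import HarnessLib

/-!
# T⁴ programme, node NE3 — census R40 (file (iv)): (HR_W) AT A CURVED BACKGROUND OF THE MULTI-LEVEL CLASS — the `ℓ^∞ → ℓ^∞` bound of B8's
# (1.38)-projection `R(W)` onto `Δ_W N(Q′(W))` from the plaquette radius and the plaquette-GRADIENT radius of `W`, with LEVEL-FREE constants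

Cell `pub-balaban-gaps` (YM blitz, track G2, seat `ne3`, unit `pub-balaban-gaps-ne3-g9`; writer prover-pub-balaban-gaps-ne3-g9-0, 2026-08-24), census
`run/shared/lean/pub/pub-balaban-gaps/ne/NE3.md` §4 R40.  WHY.  After gen 8 THE END's sup letter `hK` at the averaged background `W = cavg L U_B` was EXACTLY
(HR_W) + two regularity radii of `W` (`LandauCorrectionSupB8Cavg`).  (HR_W): for skew `(N·M)`-periodic `F` with `‖F‖_∞ ≤ B` and `μ ∈ N(Q′(W))` with
`F + Δ_Wμ ⊥ Δ_W N(Q′(W))`, `‖Δ_Wμ‖_∞ ≤ c_R·B` ([Balaban1985BackgroundPropagators] (3.25)∕(3.49) for `P = I − R`, TYPE).  THIS FILE PROVES IT at every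
background `W` of the class whose plaquettes are within `x` of `1` and whose covariant plaquette gradients are `≤ x₁`, under two LEVEL-FREE smallness
conditions on `M²x` and `M³x₁` (`M = L^{j+1}`), with `c_R` depending on `d, card n, N` only.  MECHANISM (R38's pattern with the curved bricks): `g := F + Δ_Wμ`,
`Σ nhs g ≤ Σ nhs F` (orthogonality against `ν = μ`), `h := Δ_W g ⊥ N` (`Δ_W` is `hsR`-symmetric); the `ℓ²` inverse inequality and the `ℓ¹ → ℓ^∞` step of
`LandauProjectionCurvedCore` give `‖Δ_W g‖_∞ ≤ 3(card n)²βN^d∕tentMean·B` (`β = O(M^{−2})`); the covariant lattice MEAN-VALUE INEQUALITY `CovariantMeanValue.sup_le_meanValue`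
(axial gauges of `AxialGaugeDivergence`, averaging radius `R ≍ M∕(64d²)`, gauge radius `R′ = M`) gives `‖g‖_∞ ≤ 2·card n·(Nr)^d·B + 8dRR′‖Δ_W g‖_∞` — every
power of `M` cancels:

* §1 `sum_cubeVecs_le_sum_periodBox` (a cube of side `2R+1 ≤ P` sums below the torus, periodic non-negative summand).
* §2 **`covLapSite_sup_le_curved`** — (HR_W) with explicit radii `R, R′, r` (`M ≤ r(2R+1)`, `2R+1 ≤ NM`, F3's two lines):
  `c_R = 1 + 2·card n·(N r)^d + 24·d·R·R′·(card n)²·β·N^d∕tentMean`, `β = 18d·card n·(1∕M + 2(d−1)(M−1)x)²∕tentMean²`.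
* §3 **`covLapSite_sup_le_curved_uniform`** — the choice `R′ = M`, `R = ⌊M∕(64d²)⌋`, `r = 64d²` under `256d²·M²x ≤ 1` and `16d·M³x₁ ≤ 1`:
  `c_R = 1 + 2·card n·(64d²N)^d + 27·(card n)³·512^d·N^d` — INDEPENDENT of `j` and `L`.

CONTENT (0 sorry; no `def`; [folklore] lattice analysis).  HONEST FRAMING.  A statement about ONE background of the multi-level small-field class given two
regularity radii — it discharges the binder (HR_W) of `LandauCorrectionSupB8Cavg.landauCorrectionSupB8_cavg` ∕ `SupRegularityCurvedUniform.landauCorrectionSupB8_uniform`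
into kinematics (the companion `LandauCorrectionSupB8Curved` does the plugging); nothing of Bałaban's asserted; (P♮) at curved `W`, `PairLandauGaugeB8Avg`, the covariant
root and **NE3 are NOT proved**; spine PROVED 0∕9; finite T⁴ rung (B)+1 — NOT infinite volume, NOT mass gap, NOT `BetaPertH`, NOT Clay.  PLACEMENT:
`Summits/QuantumFields/BalabanUV/T4Continuum/Spine/NE3/`; imports accepted modules only; moves nothing.  HONEST DEPENDENCY (cell page 1): continuum YM on T⁴ ⇐
BetaPertH ∧ nine spine estimates (0/9 proved); BetaPertH ⇐ (D1) ∧ (D4) ∧ CAP+tail; G-an2-4 gates asym, D1 and NE2/3/4.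
-/

set_option autoImplicit false

open scoped BigOperators Matrix Matrix.Norms.L2Operator
open NormedSpace Finset

namespace Summit.QuantumFields.BalabanUV.T4Continuum.NE3.LandauProjectionSupCurved

open Literature.MathematicalPhysics.QuantumFieldTheory.Balaban1983to89
open B7Prop1Explicit B7Prop2Explicit MatrixNorms
open T4AveragingDeficitWall (Ad IsUnitaryCfg IsSkewDir SmallField)
open T4AveragingDeficitWallBoundary (IsPeriodicCfg periodBox mem_periodBox card_periodBox sum_periodBox_shift)
open AveragingDeficitPeriodicCounting (IsPeriodicDir)
open AveragingDeficitMultiLevelPrep (LevelSmall)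
open BlockAveragePushDirGauge (gaugeDir)
open NE3NestedMeanBlockOperator (tentMean tentMean_pos inv_le_tentMean)
open NE3CovariantCalculus (hsR hsR_self nhsNormSq_sub)
open NE3CovariantWeitzenbock (covDiv)
open NE3LandauOrbit (gaugeDir_skew)
open NE3CurvedCornerGaugeSpace (covDiv_mem_skewAdjoint)
open NE3.PairLandauB8 (avgKernelGauges covLapSite)
open NE3.LandauProjectionB8 (covDiv_gaugeDir_eq_covLapSite covLapSite_add_period)
open NE3.LandauProjectionCurvedFix (sum_hsR_covLapSite_symm)
open NE3.LandauProjectionCurvedCore (sum_nhsNormSq_covLapSite_le_of_perp norm_le_of_perp)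
open NE3.CovariantMeanValue (sup_le_meanValue)
open NE3.LandauCorrectionSupB8LocalGauge (norm_axial_sub_one_le_cube)
open NE3.AxialGaugeDivergence (norm_axialDivergence_le)

noncomputable section

variable {d : ℕ} {n : Type*} [Fintype n] [DecidableEq n]

/-! ## §1 Cube sums below torus sums -/

omit [Fintype n] [DecidableEq n] in
/-- **A CUBE OF SIDE `2R+1 ≤ P` SUMS BELOW THE TORUS**: for a non-negative `P`-periodic `f` and every centre `x₀`, `Σ_{m∈[−R,R]^d} f(x₀+m) ≤ Σ_{y∈[0,P)^d} f y`
(translate the cube into the period box — injective since `2R+1 ≤ P` — and use shift-invariance of periodic sums). [folklore] -/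
theorem sum_cubeVecs_le_sum_periodBox {P R : ℕ} (hRP : 2 * R + 1 ≤ P) {f : Site d → ℝ} (hf0 : ∀ y, 0 ≤ f y)
    (hfP : ∀ (y : Site d) (i : Fin d), f (y + (P : ℤ) • e i) = f y) (x₀ : Site d) :
    ∑ m ∈ (Fintype.piFinset fun _ : Fin d => Finset.Icc (-(R : ℤ)) (R : ℤ)), f (x₀ + m) ≤ ∑ y ∈ periodBox (d := d) P, f y := by
  classical
  have hP : 1 ≤ P := by omega
  set c : Site d := fun _ => (R : ℤ) with hc
  have himg : (Fintype.piFinset fun _ : Fin d => Finset.Icc (-(R : ℤ)) (R : ℤ)).image (fun m => m + c) ⊆ periodBox (d := d) P := by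
    intro v hv
    obtain ⟨m, hm, rfl⟩ := Finset.mem_image.1 hv
    rw [mem_periodBox]
    intro κ
    have h1 := Fintype.mem_piFinset.mp hm κ
    rw [Finset.mem_Icc] at h1
    simp only [Pi.add_apply, hc]
    constructor <;> omega
  calc ∑ m ∈ (Fintype.piFinset fun _ : Fin d => Finset.Icc (-(R : ℤ)) (R : ℤ)), f (x₀ + m) = ∑ m ∈ (Fintype.piFinset fun _ : Fin d => Finset.Icc (-(R : ℤ)) (R : ℤ)), f ((m + c) + (x₀ - c)) :=
        Finset.sum_congr rfl fun m _ => by congr 1; abel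
    _ = ∑ v ∈ (Fintype.piFinset fun _ : Fin d => Finset.Icc (-(R : ℤ)) (R : ℤ)).image (fun m => m + c), f (v + (x₀ - c)) := by
        rw [Finset.sum_image fun a _ b _ h => add_right_cancel h]
    _ ≤ ∑ v ∈ periodBox (d := d) P, f (v + (x₀ - c)) := Finset.sum_le_sum_of_subset_of_nonneg himg fun v _ _ => hf0 _
    _ = ∑ v ∈ periodBox (d := d) P, f v := sum_periodBox_shift P hP hfP (x₀ - c)

/-! ## §2 (HR_W) at a curved background with explicit radii -/

/-- **(HR_W) AT A CURVED BACKGROUND OF THE CLASS, EXPLICIT RADII** (`d ≥ 1`, `L ≥ 2`, `N ≥ 1`, `j`; `M = L^{j+1}`, `P = N·M`; `W` unitary `P`-periodic with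
`LevelSmall d L j x`, `SmallField W x` and covariant plaquette gradients `≤ x₁`; averaging radius `R`, gauge radius `R′ ≥ 1` and ratio `r ≥ 1` with `M ≤ r(2R+1)`,
`2R+1 ≤ P`, and the two lines of `CovariantMeanValue.sup_le_meanValue` for `a = 2d(R′+1)x`, `δ = 2d²(R′+1)x₁ + 8d³(R′+1)²x²`): for skew `P`-periodic `F` with
`‖F‖_∞ ≤ B`, `μ ∈ N(Q′(W))`, `F + Δ_Wμ ⊥ Δ_W N(Q′(W))` in `hsR`-sums over the period box, and every `y`:
`‖Δ_Wμ(y)‖ ≤ (1 + 2·card n·(N r)^d + 24·d·R·R′·(card n)²·β·N^d∕tentMean(d,M))·B`, `β = 18d·card n·(1∕M + 2(d−1)(M−1)x)²∕tentMean(d,M)²`. [folklore] -/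
theorem covLapSite_sup_le_curved [Nonempty n] (hd : 1 ≤ d) {L N : ℕ} (hL : 2 ≤ L) (hN : 1 ≤ N) (j : ℕ)
    {W : Site d → Fin d → (Matrix n n ℂ)ˣ} {x x₁ : ℝ} (hWu : IsUnitaryCfg W) (hWP : IsPeriodicCfg W ((N * L ^ (j + 1) : ℕ) : ℤ))
    (hx : 0 ≤ x) (hs : LevelSmall d L j x) (hWx : SmallField W x) (hx10 : 0 ≤ x₁)
    (hgrad : ∀ (p : Site d) (μ κ : Fin d), κ ≠ μ →
      ‖Ad (W p μ) ((hol W (p + e μ) (plaqWord κ μ) : (Matrix n n ℂ)ˣ) : Matrix n n ℂ) - ((hol W p (plaqWord κ μ) : (Matrix n n ℂ)ˣ) : Matrix n n ℂ)‖ ≤ x₁)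
    {R R' r : ℕ} (hR' : 1 ≤ R') (hr : 1 ≤ r) (hRr : ((L ^ (j + 1) : ℕ) : ℝ) ≤ (r : ℝ) * (2 * (R : ℝ) + 1)) (hRP : 2 * R + 1 ≤ N * L ^ (j + 1))
    (ha : 16 * R' * d * (2 * (d : ℝ) * (R' + 1) * x) ≤ 1 / 2)
    (hline : 4 * (d : ℝ) * R * (2 * (d : ℝ) / R' + 4 * R' * (2 * (d : ℝ) ^ 2 * (R' + 1) * x₁ + 8 * (d : ℝ) ^ 3 * ((R' : ℝ) + 1) ^ 2 * x ^ 2)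
        + 24 * R' * d * (2 * (d : ℝ) * (R' + 1) * x) ^ 2 + 2 * (2 * (d : ℝ) * (R' + 1) * x)) ≤ 1 / 2)
    (F : Site d → Matrix n n ℂ) (hFs : ∀ y : Site d, F y ∈ skewAdjoint (Matrix n n ℂ))
    (hFP : ∀ (y : Site d) (i : Fin d), F (y + ((N * L ^ (j + 1) : ℕ) : ℤ) • e i) = F y)
    {mu : Site d → Matrix n n ℂ} (hmu : mu ∈ avgKernelGauges (d := d) (n := n) L N (j + 1) W)
    (horth : ∀ nu ∈ avgKernelGauges (d := d) (n := n) L N (j + 1) W,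
      ∑ y ∈ periodBox (d := d) (N * L ^ (j + 1)), hsR (F y + covLapSite W mu y) (covLapSite W nu y) = 0)
    {B : ℝ} (hFB : ∀ y : Site d, ‖F y‖ ≤ B) (y : Site d) :
    ‖covLapSite W mu y‖
      ≤ (1 + 2 * (Fintype.card n : ℝ) * ((N : ℝ) * r) ^ d
          + 24 * (d : ℝ) * R * R' * (Fintype.card n : ℝ) ^ 2
              * (18 * (d : ℝ) * Fintype.card n
                  * (1 / (((L ^ (j + 1) : ℕ) : ℝ)) + 2 * (((d : ℝ) - 1) * ((((L ^ (j + 1) : ℕ) : ℝ)) - 1) * x)) ^ 2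
                  / tentMean d (L ^ (j + 1)) ^ 2)
              * (N : ℝ) ^ d / tentMean d (L ^ (j + 1))) * B := by
  classical
  have hL1 : 1 ≤ L := by omega
  -- names
  set M : ℕ := L ^ (j + 1) with hM_def
  have hM2 : 2 ≤ M := le_trans hL (Nat.le_self_pow (by omega) L)
  have hM1 : 1 ≤ M := by omega
  have hM0 : (0 : ℝ) < (M : ℝ) := by exact_mod_cast (by omega : 0 < M)
  set P : ℕ := N * M with hP_def
  have hP : 1 ≤ P := Nat.mul_pos (by omega) (by omega)
  have hP0 : (0 : ℝ) < P := by exact_mod_cast hP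
  have hN0 : (0 : ℝ) < N := by exact_mod_cast hN
  have hPNM : (P : ℝ) = (N : ℝ) * M := by rw [hP_def]; push_cast; ring
  set cn : ℝ := (Fintype.card n : ℝ) with hcn_def
  have hcn1 : (1 : ℝ) ≤ cn := by rw [hcn_def]; exact_mod_cast Fintype.card_pos
  have hcn0 : 0 ≤ cn := by linarith
  set tm : ℝ := tentMean d M with htm_def
  have htm0 : 0 < tm := tentMean_pos hM2 d
  set β : ℝ := 18 * (d : ℝ) * cn * (1 / ((M : ℕ) : ℝ) + 2 * (((d : ℝ) - 1) * ((((M : ℕ) : ℝ)) - 1) * x)) ^ 2 / tm ^ 2 with hβ_def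
  have hβ0 : 0 ≤ β := by positivity
  have hB0 : 0 ≤ B := (norm_nonneg _).trans (hFB 0)
  have hmus := hmu.1
  have hmuP := hmu.2.1
  -- `g := F + Δ_Wμ`: skew, periodic
  set g : Site d → Matrix n n ℂ := fun z => F z + covLapSite W mu z with hg_def
  have hlaps : ∀ z : Site d, covLapSite W mu z ∈ skewAdjoint (Matrix n n ℂ) := fun z => by
    rw [← covDiv_gaugeDir_eq_covLapSite]; exact covDiv_mem_skewAdjoint hWu (gaugeDir_skew hWu hmus) z
  have hgs : ∀ z : Site d, g z ∈ skewAdjoint (Matrix n n ℂ) := fun z => (skewAdjoint _).add_mem (hFs z) (hlaps z)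
  have hgP : ∀ (z : Site d) (i : Fin d), g (z + (P : ℤ) • e i) = g z := fun z i => by
    simp only [hg_def, hFP z i, covLapSite_add_period hWP hmuP z i]
  have horth' : ∀ nu ∈ avgKernelGauges (d := d) (n := n) L N (j + 1) W,
      ∑ z ∈ periodBox (d := d) P, hsR (g z) (covLapSite W nu z) = 0 := horth
  -- `Σ nhs g ≤ P^d B²` (orthogonality against `ν := μ`)
  set Gn : ℝ := ∑ z ∈ periodBox (d := d) P, nhsNormSq (g z) with hGn_def
  have hGn0 : 0 ≤ Gn := Finset.sum_nonneg fun z _ => nhsNormSq_nonneg _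
  have hGnF : Gn ≤ (P : ℝ) ^ d * B ^ 2 := by
    have h1 : ∀ z, nhsNormSq (F z) = nhsNormSq (g z) + nhsNormSq (covLapSite W mu z) - 2 * hsR (g z) (covLapSite W mu z) := fun z => by
      rw [← nhsNormSq_sub]; simp [hg_def]
    have h2 : ∑ z ∈ periodBox (d := d) P, nhsNormSq (F z) = Gn + ∑ z ∈ periodBox (d := d) P, nhsNormSq (covLapSite W mu z) := by
      simp only [h1, Finset.sum_sub_distrib, Finset.sum_add_distrib, ← Finset.mul_sum, horth' mu hmu]
      ring
    have h3 : ∑ z ∈ periodBox (d := d) P, nhsNormSq (F z) ≤ (P : ℝ) ^ d * B ^ 2 := by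
      calc ∑ z ∈ periodBox (d := d) P, nhsNormSq (F z) ≤ ∑ _z ∈ periodBox (d := d) P, B ^ 2 :=
            Finset.sum_le_sum fun z _ => (nhsNormSq_le_opNorm_sq _).trans (pow_le_pow_left₀ (norm_nonneg _) (hFB z) 2)
        _ = (P : ℝ) ^ d * B ^ 2 := by rw [Finset.sum_const, card_periodBox, nsmul_eq_mul]; push_cast; ring
    have h4 : 0 ≤ ∑ z ∈ periodBox (d := d) P, nhsNormSq (covLapSite W mu z) := Finset.sum_nonneg fun z _ => nhsNormSq_nonneg _
    linarith
  -- `h := Δ_W g ⊥ N(Q′(W))` (symmetry of `Δ_W`)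
  set h : Site d → Matrix n n ℂ := covLapSite W g with hh_def
  have hhs : ∀ z, h z ∈ skewAdjoint (Matrix n n ℂ) := fun z => by
    rw [hh_def, ← covDiv_gaugeDir_eq_covLapSite]; exact covDiv_mem_skewAdjoint hWu (gaugeDir_skew hWu hgs) z
  have hhP : ∀ (z : Site d) (i : Fin d), h (z + (P : ℤ) • e i) = h z := fun z i => covLapSite_add_period hWP hgP z i
  have hperp : ∀ nu ∈ avgKernelGauges (d := d) (n := n) L N (j + 1) W, ∑ z ∈ periodBox (d := d) P, hsR (h z) (nu z) = 0 := by
    intro nu hnu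
    rw [hh_def, sum_hsR_covLapSite_symm hP hWu hWP hgP hnu.2.1]
    exact horth' nu hnu
  -- the `ℓ²` inverse inequality: `A := Σ nhs h ≤ β² Gn`
  set A : ℝ := ∑ z ∈ periodBox (d := d) P, nhsNormSq (h z) with hA_def
  have hA0 : 0 ≤ A := Finset.sum_nonneg fun z _ => nhsNormSq_nonneg _
  have hAβ : A ≤ β ^ 2 * Gn := sum_nhsNormSq_covLapSite_le_of_perp hL hN j hWu hWP hx hs hWx hgs hgP hperp
  -- the `ℓ¹ → ℓ^∞` step: `‖h‖_∞ ≤ Bh := 3cn²βN^d B / tm`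
  set S₁ : ℝ := ∑ z ∈ periodBox (d := d) P, ‖h z‖ with hS₁_def
  have hS₁0 : 0 ≤ S₁ := Finset.sum_nonneg fun z _ => norm_nonneg _
  set Bh : ℝ := 3 * cn ^ 2 * β * (N : ℝ) ^ d * B / tm with hBh_def
  have hBh0 : 0 ≤ Bh := by positivity
  have hMd : (0 : ℝ) < ((M : ℕ) : ℝ) ^ d := by positivity
  have hPdMd : (((M : ℕ) : ℝ) ^ d)⁻¹ * (P : ℝ) ^ d = (N : ℝ) ^ d := by
    rw [hPNM, mul_pow]; field_simp
  have hhsup : ∀ z : Site d, ‖h z‖ ≤ Bh := by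
    intro z
    have h1 : ‖h z‖ ≤ 3 * cn / tm * ((((M : ℕ) : ℝ) ^ d)⁻¹ * S₁) := norm_le_of_perp hL hN j hWu hWP hx hs hWx hhs hhP hperp z
    -- `S₁² ≤ P^d Σ‖h‖² ≤ P^d cn A ≤ P^d cn β² P^d B²`
    have h2 : S₁ ^ 2 ≤ (P : ℝ) ^ d * (cn * (β ^ 2 * ((P : ℝ) ^ d * B ^ 2))) := by
      have hcs := sq_sum_le_card_mul_sum_sq (s := periodBox (d := d) P) (f := fun z => ‖h z‖)
      rw [card_periodBox] at hcs; push_cast at hcs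
      refine hcs.trans (mul_le_mul_of_nonneg_left ?_ (by positivity))
      calc ∑ z ∈ periodBox (d := d) P, ‖h z‖ ^ 2 ≤ cn * A := by
            rw [hA_def, Finset.mul_sum]; exact Finset.sum_le_sum fun z _ => opNorm_sq_le_card_mul_nhsNormSq (h z)
        _ ≤ cn * (β ^ 2 * ((P : ℝ) ^ d * B ^ 2)) := mul_le_mul_of_nonneg_left (hAβ.trans (mul_le_mul_of_nonneg_left hGnF (sq_nonneg _))) hcn0
    have h3 : (3 * cn / tm * ((((M : ℕ) : ℝ) ^ d)⁻¹ * S₁)) ^ 2 ≤ Bh ^ 2 := by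
      have e1 : (3 * cn / tm * ((((M : ℕ) : ℝ) ^ d)⁻¹ * S₁)) ^ 2 = (3 * cn / tm) ^ 2 * ((((M : ℕ) : ℝ) ^ d)⁻¹) ^ 2 * S₁ ^ 2 := by ring
      have e2 : Bh ^ 2 = (3 * cn / tm) ^ 2 * ((((M : ℕ) : ℝ) ^ d)⁻¹) ^ 2 * ((P : ℝ) ^ d * (cn * (β ^ 2 * ((P : ℝ) ^ d * B ^ 2)))) * cn := by
        rw [hBh_def]
        have : (N : ℝ) ^ d = (((M : ℕ) : ℝ) ^ d)⁻¹ * (P : ℝ) ^ d := hPdMd.symm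
        rw [this]; field_simp
      rw [e1, e2]
      have h4 : (3 * cn / tm) ^ 2 * ((((M : ℕ) : ℝ) ^ d)⁻¹) ^ 2 * S₁ ^ 2
          ≤ (3 * cn / tm) ^ 2 * ((((M : ℕ) : ℝ) ^ d)⁻¹) ^ 2 * ((P : ℝ) ^ d * (cn * (β ^ 2 * ((P : ℝ) ^ d * B ^ 2)))) :=
        mul_le_mul_of_nonneg_left h2 (by positivity)
      exact h4.trans (le_mul_of_one_le_right (by positivity) hcn1)
    exact h1.trans ((pow_le_pow_iff_left₀ (by positivity) hBh0 two_ne_zero).mp h3)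
  -- the mean-value inequality for `g` with `‖Δ_W g‖_∞ ≤ Bh`
  have hS₂ : ∀ x₀ : Site d, ∑ m ∈ (Fintype.piFinset fun _ : Fin d => Finset.Icc (-(R : ℤ)) (R : ℤ)), ‖g (x₀ + m)‖ ^ 2 ≤ cn * ((P : ℝ) ^ d * B ^ 2) := by
    intro x₀
    have h1 := sum_cubeVecs_le_sum_periodBox (d := d) hRP (f := fun z => ‖g z‖ ^ 2) (fun z => sq_nonneg _) (fun z i => by simp only [hgP z i]) x₀
    refine h1.trans ?_
    calc ∑ z ∈ periodBox (d := d) P, ‖g z‖ ^ 2 ≤ cn * Gn := by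
          rw [hGn_def, Finset.mul_sum]; exact Finset.sum_le_sum fun z _ => opNorm_sq_le_card_mul_nhsNormSq (g z)
      _ ≤ cn * ((P : ℝ) ^ d * B ^ 2) := mul_le_mul_of_nonneg_left hGnF hcn0
  have hmv := sup_le_meanValue hd hP hWu hWP hgP hR' (a := 2 * (d : ℝ) * (R' + 1) * x)
    (δ := 2 * (d : ℝ) ^ 2 * (R' + 1) * x₁ + 8 * (d : ℝ) ^ 3 * ((R' : ℝ) + 1) ^ 2 * x ^ 2) (by positivity) (fun z => hhsup z)
    (fun y₀ _ => ⟨axialFn W (y₀ - fun _ => (R' : ℤ) + 1), fun z => hol_mem_of (S := unitaryUnits (Matrix n n ℂ)) hWu _ _,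
      fun z ν hz => norm_axial_sub_one_le_cube hWu hx hWx y₀ R' z ν hz,
      fun z hz => norm_axialDivergence_le hWu hx hx10 hWx hgrad y₀ R' z hz⟩) ha hS₂ hline y
  -- `√(cn P^d B²/(2R+1)^d) ≤ cn (N r)^d B`
  have hsqrt : Real.sqrt (cn * ((P : ℝ) ^ d * B ^ 2) / (2 * (R : ℝ) + 1) ^ d) ≤ cn * ((N : ℝ) * r) ^ d * B := by
    have hR0 : (0 : ℝ) < 2 * (R : ℝ) + 1 := by positivity
    have hR0d : (0 : ℝ) < (2 * (R : ℝ) + 1) ^ d := pow_pos hR0 d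
    have hr1 : (1 : ℝ) ≤ r := by exact_mod_cast hr
    have hN1 : (1 : ℝ) ≤ N := by exact_mod_cast hN
    have hMr : (M : ℝ) ^ d ≤ (r : ℝ) ^ d * (2 * (R : ℝ) + 1) ^ d := by
      rw [← mul_pow]; exact pow_le_pow_left₀ hM0.le (by exact_mod_cast hRr) d
    have h1 : cn * ((P : ℝ) ^ d * B ^ 2) / (2 * (R : ℝ) + 1) ^ d ≤ (cn * ((N : ℝ) * r) ^ d * B) ^ 2 := by
      set K : ℝ := cn * ((N : ℝ) ^ d * (r : ℝ) ^ d) with hK_def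
      have hK1 : 1 ≤ K := one_le_mul_of_one_le_of_one_le hcn1 (one_le_mul_of_one_le_of_one_le (one_le_pow₀ hN1) (one_le_pow₀ hr1))
      have hK0 : 0 ≤ K := by linarith
      have e1 : (cn * ((N : ℝ) * r) ^ d * B) ^ 2 = K ^ 2 * B ^ 2 := by rw [hK_def, mul_pow]; ring
      rw [div_le_iff₀ hR0d, e1, hPNM, mul_pow]
      calc cn * ((N : ℝ) ^ d * (M : ℝ) ^ d * B ^ 2) ≤ cn * ((N : ℝ) ^ d * ((r : ℝ) ^ d * (2 * (R : ℝ) + 1) ^ d) * B ^ 2) := by gcongr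
        _ = K * (B ^ 2 * (2 * (R : ℝ) + 1) ^ d) := by rw [hK_def]; ring
        _ ≤ K ^ 2 * (B ^ 2 * (2 * (R : ℝ) + 1) ^ d) :=
            mul_le_mul_of_nonneg_right (le_self_pow₀ hK1 two_ne_zero) (mul_nonneg (sq_nonneg B) hR0d.le)
        _ = K ^ 2 * B ^ 2 * (2 * (R : ℝ) + 1) ^ d := by ring
    calc Real.sqrt (cn * ((P : ℝ) ^ d * B ^ 2) / (2 * (R : ℝ) + 1) ^ d) ≤ Real.sqrt ((cn * ((N : ℝ) * r) ^ d * B) ^ 2) := Real.sqrt_le_sqrt h1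
      _ = cn * ((N : ℝ) * r) ^ d * B := Real.sqrt_sq (by positivity)
  -- assemble
  have hgy : ‖g y‖ ≤ 2 * (cn * ((N : ℝ) * r) ^ d * B) + 8 * (d : ℝ) * R * R' * Bh := by
    refine hmv.trans ?_
    have : 2 * Real.sqrt (cn * ((P : ℝ) ^ d * B ^ 2) / (2 * (R : ℝ) + 1) ^ d) ≤ 2 * (cn * ((N : ℝ) * r) ^ d * B) := by linarith [hsqrt]
    linarith
  have hfin : covLapSite W mu y = g y - F y := by simp only [hg_def]; abel
  rw [hfin]
  calc ‖g y - F y‖ ≤ ‖g y‖ + ‖F y‖ := norm_sub_le _ _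
    _ ≤ (2 * (cn * ((N : ℝ) * r) ^ d * B) + 8 * (d : ℝ) * R * R' * Bh) + B := add_le_add hgy (hFB y)
    _ = (1 + 2 * cn * ((N : ℝ) * r) ^ d + 24 * (d : ℝ) * R * R' * cn ^ 2 * β * (N : ℝ) ^ d / tm) * B := by
        rw [hBh_def]; ring

end

end Summit.QuantumFields.BalabanUV.T4Continuum.NE3.LandauProjectionSupCurved
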